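import Literature.NumberTheory.Li1992.RallisLocalFactorSplitGeneral
import Literature.NumberTheory.GelbartRogawski1991.LocalUnitarySplitPlaceDarboux
import HarnessLib

/-!
# [Li1992, Thm 2.1 (27) / §5] — the local integrals at a split place for general test vectors: the HYPOTHESIS-FREE form

Sequel of `RallisLocalFactorSplitGeneral.lean`.  There the absolute integrability over `U(J₁)(F_v)` of the matrix coefficients
`h ↦ ⟨ω_v(h · 1_N)Φ, Φ'⟩` (arbitrary `Φ, Φ' ∈ 𝒮(F_vᴺ)`) was proved from split-place Darboux data and a coset decomposition
`U(J₁)(F_v) = ⋃_m z₀^m K`.  Here both inputs are DISCHARGED at EVERY place `v` of `F` split in `E` — including the finitely many places where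
`J₁` is not a unit, which the generator lemma ★ `exists_generator_localPi_one_of_split` does not cover:

* the Darboux data are ★ `splitDarboux`, ★ `splitCoord`, ★ `valued_splitCoord`, ★ `iota_localCenter_eq` of `LocalUnitarySplitPlaceDarboux`;
* the coset decomposition uses the subgroup `K₀ = {h : |h_w|_w = 1}` — the preimage of `GL₁(𝒪_w)` under the split-place isomorphism
  `U(J₁)(F_v) ≃ₜ* GL₁(E_w)`, `u ↦ u_w` (★ `localPiSplitEquiv`; it needs only `J₁ 0 0 ≠ 0`) — which is compact open, and the pull-back `z₀`
  of a uniformiser of `E_w`, for which `U(J₁)(F_v) = ⋃_m z₀^m K₀` is Tate's `E_w^× = ⊔_m ϖ^m 𝒪_w^×` ([TateThesis1967, §3.2]).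

Main statement: **`integrable_localCoeff_of_split`** — for `E/F` CM-type data as in the tree's `FinLocalSplittings`, `c ≠ 1`, `J₁` hermitian,
`N ≥ 1`, a place `w ∣ v` with `c w ≠ w`, `ω_v` `L²(μ'ᴺ)`-isometric, every left-invariant measure `dh` on `U(J₁)(F_v)` finite on compacts and all
`Φ, Φ' ∈ 𝒮(F_vᴺ)`: `h ↦ ∫ (ω_v(h · 1_N)Φ) conj Φ' dμ'ᴺ` is `dh`-integrable ([Li1992, §5 p. 206]: the local integrals at the split places
converge absolutely; [Weil1965, n° 51]).  This is the local input, at the finitely many «bad» split places, of conjunct (ii) of `StubSW2` of the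
E-2 child line of crux H413 (road C; cell hodgecm-mathlib, FLOOR 0, `--supports stmt-HodgeConjecture-24833`).

KERNEL only: theorems, no definition, no named fact, no `sorry`.  HC_CM is proved only modulo the printed citations until rung 0 closes; nothing
here is a claim about them.

## References
* [Li1992] J.-S. Li, J. reine angew. Math. 428 (1992) 177–217 — Thm 2.1 (27) p. 184; §5 p. 206.
* [TateThesis1967] J. Tate, in Cassels–Fröhlich, *Algebraic Number Theory* (1967), Ch. XV §3.2.
* [PlatonovRapinchuk1994] V. Platonov, A. Rapinchuk, *Algebraic Groups and Number Theory* (1994), §5.1.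
* [Weil1965] A. Weil, Acta Math. 113 (1965) 1–87 — n° 51.
-/

set_option autoImplicit false

noncomputable section

open NumberField IsDedekindDomain MeasureTheory Filter Set
open scoped Matrix NNReal Topology ComplexConjugate
open Literature.RepresentationTheory Literature.RepresentationTheory.HeisenbergGroup
open Literature.NumberTheory.Automorphic
open Literature.NumberTheory.Automorphic.UnitaryGroup
open Literature.NumberTheory.Automorphic.Liu2021
open Literature.NumberTheory.GaloisRepresentations.IsNonarchimedeanLocalField

namespace Literature.NumberTheory.GelbartRogawski1991.UnitaryDualPair.LocalSplitting.FinLocalSplittings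

variable {F : Type} [Field F] [NumberField F] {E : Type} [Field E] [NumberField E] [Algebra F E]
  [Algebra.IsQuadraticExtension F E] {c : E ≃ₐ[F] E} {N : ℕ} {δ : E} {hcδ : c δ = -δ} {hδ : δ ≠ 0} {d : F}
  {hd : δ * δ = algebraMap F E d} {T : Matrix (Fin N) (Fin N) F} {hT : T.IsSymm}
  {J : Matrix (Fin N) (Fin N) E} {hJ : J = T.map (algebraMap F E)}
  (𝓢 : FinLocalSplittings F E c N hcδ hδ hd T hT hJ) (J₁ : Matrix (Fin 1) (Fin 1) E) (hJ₁ : J₁ 0 0 ≠ 0)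
  (hTd : IsUnit T.det) (v : HeightOneSpectrum (𝓞 F))

/-! ## §1 The coset decomposition `U(J₁)(F_v) = ⋃_m z₀^m K₀`, `K₀ = {|h_w| = 1}`, at every split place -/

include hJ₁ in
/-- **Tate's decomposition of the split torus, `J₁`-unit-free**: at a split `w ∣ v` there are a compact open subgroup `K₀ ≤ U(J₁)(F_v)` on which
the `w`-entry has valuation `1` and an element `z₀` whose `w`-entry has valuation `exp (−1)` (a uniformiser) with `U(J₁)(F_v) = ⋃_m z₀^m K₀`
(`K₀` = the preimage of `GL₁(𝒪_w)` under ★ `localPiSplitEquiv`, `u ↦ u_w`). [cite: TateThesis1967, §3.2] [cite: PlatonovRapinchuk1994, §5.1] -/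
theorem exists_compactOpen_and_generator_of_split (hc : c ≠ 1) (hJ₁c : (J₁.map c)ᵀ = J₁) (w : PlacesOver E v) (hw : c • w.1 ≠ w.1) :
    ∃ (K₀ : Subgroup (localPi E c 1 J₁ v)) (z₀ : localPi E c 1 J₁ v),
      IsOpen (K₀ : Set (localPi E c 1 J₁ v)) ∧ IsCompact (K₀ : Set (localPi E c 1 J₁ v)) ∧
      (∀ k ∈ K₀, Valued.v ((((k : localPi E c 1 J₁ v) : LocalGLPi E 1 v) w : Matrix (Fin 1) (Fin 1) (w.1.adicCompletion E)) 0 0) = 1) ∧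
      Valued.v ((((z₀ : localPi E c 1 J₁ v) : LocalGLPi E 1 v) w : Matrix (Fin 1) (Fin 1) (w.1.adicCompletion E)) 0 0) =
        WithZero.exp (-1 : ℤ) ∧
      ∀ h : localPi E c 1 J₁ v, ∃ m : ℤ, (z₀ ^ m)⁻¹ * h ∈ K₀ := by
  -- the split-place isomorphism `e : U(J₁)(F_v) ≃ₜ* GL₁(E_w)`, `u ↦ u_w`
  have hj0 : algebraMap E (w.1.adicCompletion E) (J₁ 0 0) ≠ 0 :=
    (map_ne_zero_iff _ (algebraMap E (w.1.adicCompletion E)).injective).2 hJ₁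
  have hJw : IsUnit (placeForm J₁ w.1) := by
    rw [Matrix.isUnit_iff_isUnit_det, Matrix.det_fin_one]
    exact isUnit_iff_ne_zero.2 hj0
  set e := localPiSplitEquiv c J₁ hc hJ₁c w hw hJw with he
  -- `K₀ = e⁻¹(GL₁(𝒪_w))`
  let K₀ : Subgroup (localPi E c 1 J₁ v) := (glInt 1 (w.1.adicCompletion E)).comap e.toMonoidHom
  have hK₀mem : ∀ k : localPi E c 1 J₁ v, k ∈ K₀ ↔ ((k : LocalGLPi E 1 v) w) ∈ glInt 1 (w.1.adicCompletion E) := fun k => Iff.rfl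
  have hK₀set : (K₀ : Set (localPi E c 1 J₁ v)) = e ⁻¹' (glInt 1 (w.1.adicCompletion E) : Set (GL (Fin 1) (w.1.adicCompletion E))) := rfl
  have hKo : IsOpen (K₀ : Set (localPi E c 1 J₁ v)) := by
    rw [hK₀set]; exact (isOpen_glInt 1 (w.1.adicCompletion E)).preimage e.continuous
  have hKc : IsCompact (K₀ : Set (localPi E c 1 J₁ v)) := by
    rw [hK₀set]
    exact e.toHomeomorph.isCompact_preimage.2 (isCompact_glInt 1 (w.1.adicCompletion E))
  have hK1 : ∀ k ∈ K₀, Valued.v ((((k : localPi E c 1 J₁ v) : LocalGLPi E 1 v) w :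
      Matrix (Fin 1) (Fin 1) (w.1.adicCompletion E)) 0 0) = 1 := fun k hk => by
    rw [← coe_det_apply_eq_entry J₁ v w]
    exact (valued_det_eq_one_iff_mem_glInt_one _).2 ((hK₀mem k).1 hk)
  -- a uniformiser `π` of `E_w` as `g₀ ∈ GL₁(E_w)`, `z₀ := e⁻¹ g₀`
  obtain ⟨π, hπ⟩ := IsDedekindDomain.HeightOneSpectrum.valuation_exists_uniformizer E w.1
  have hπv : Valued.v (algebraMap E (w.1.adicCompletion E) π) = WithZero.exp (-1 : ℤ) := by
    rw [show algebraMap E (w.1.adicCompletion E) π = (π : w.1.adicCompletion E) from rfl,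
      IsDedekindDomain.HeightOneSpectrum.valuedAdicCompletion_eq_valuation', hπ]
  have hπ0 : algebraMap E (w.1.adicCompletion E) π ≠ 0 := fun h0 => by
    rw [h0, map_zero] at hπv; exact WithZero.exp_ne_zero hπv.symm
  let g₀ : GL (Fin 1) (w.1.adicCompletion E) :=
    Matrix.GeneralLinearGroup.mkOfDetNeZero !![algebraMap E (w.1.adicCompletion E) π]
      (by rw [Matrix.det_fin_one_of]; exact hπ0)
  have hg₀ : Valued.v ((Matrix.GeneralLinearGroup.det g₀ : (w.1.adicCompletion E)ˣ) : w.1.adicCompletion E) =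
      WithZero.exp (-1 : ℤ) := by
    rw [Matrix.GeneralLinearGroup.val_det_apply, Matrix.GeneralLinearGroup.val_mkOfDetNeZero, Matrix.det_fin_one_of]
    exact hπv
  have hez₀ : e (e.symm g₀) = g₀ := e.apply_symm_apply g₀
  refine ⟨K₀, e.symm g₀, hKo, hKc, hK1, ?_, fun h => ?_⟩
  · rw [← coe_det_apply_eq_entry J₁ v w, ← localPiSplitEquiv_apply c J₁ hc hJ₁c w hw hJw, ← he, hez₀]
    exact hg₀
  · -- `m := -log v(det h_w)`
    set y : (w.1.adicCompletion E)ˣ := Matrix.GeneralLinearGroup.det (e h) with hy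
    have hy0 : Valued.v (y : w.1.adicCompletion E) ≠ 0 := (Valuation.ne_zero_iff _).2 (Units.ne_zero _)
    set m : ℤ := -WithZero.log (Valued.v (y : w.1.adicCompletion E)) with hm
    refine ⟨m, ?_⟩
    rw [hK₀mem, ← valued_det_eq_one_iff_mem_glInt_one, ← localPiSplitEquiv_apply c J₁ hc hJ₁c w hw hJw, ← he, map_mul, map_inv,
      map_zpow, hez₀, map_mul, map_inv, map_zpow, Units.val_mul, Units.val_inv_eq_inv_val, Units.val_zpow_eq_zpow_val, map_mul,
      map_inv₀, map_zpow₀, hg₀, ← hy, ← WithZero.exp_zsmul, smul_eq_mul, mul_neg, mul_one, ← WithZero.exp_neg, neg_neg,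
      ← WithZero.exp_log hy0, ← WithZero.exp_add, hm, neg_add_cancel, WithZero.exp_zero]

/-! ## §2 Absolute integrability at every split place -/

include hTd in
/-- **ABSOLUTE INTEGRABILITY OF THE LOCAL MATRIX COEFFICIENTS AT EVERY SPLIT PLACE, GENERAL TEST VECTORS** ([Li1992, §5 p. 206]; the local
input of [Weil1965, n° 51] at the split places).  For `c ≠ 1`, `J₁` hermitian (`(J₁.map c)ᵀ = J₁`, `J₁ 0 0 ≠ 0`), `N ≥ 1`, a place `w ∣ v` of `E`
with `c w ≠ w`, and `ω_v` `L²(μ'ᴺ)`-isometric: for every left-invariant measure `dh` on `U(J₁)(F_v)` finite on compacts and all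
`Φ, Φ' ∈ 𝒮(F_vᴺ)`, the matrix coefficient `h ↦ ∫ (ω_v(h · 1_N)Φ) conj Φ' dμ'ᴺ` is `dh`-integrable — with NO unit ∕ unramifiedness hypothesis on
`J₁`, `ψ_v`, `T` or `2` (the Darboux data ★ `splitDarboux` ∕ `splitCoord` ∕ `iota_localCenter_eq` and the coset decomposition of
`exists_compactOpen_and_generator_of_split` hold at every split place). [cite: Li1992, Thm 2.1 (27) p. 184; §5 p. 206] [cite: TateThesis1967, §3.2] -/
theorem integrable_localCoeff_of_split [NeZero N] (hc : c ≠ 1) (hJ₁c : (J₁.map c)ᵀ = J₁) (w : PlacesOver E v) (hw : c • w.1 ≠ w.1)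
    [MeasurableSpace (v.adicCompletion F)] [BorelSpace (v.adicCompletion F)] (μ' : Measure (v.adicCompletion F))
    [μ'.IsAddHaarMeasure] (hL2 : (𝓢.omegaLoc v).IsL2Isometric (Measure.pi fun _ : Fin N => μ'))
    [MeasurableSpace (localPi E c 1 J₁ v)] [BorelSpace (localPi E c 1 J₁ v)] (dh : Measure (localPi E c 1 J₁ v))
    [dh.IsMulLeftInvariant] [IsFiniteMeasureOnCompacts dh]
    (Φ Φ' : SchwartzBruhat (Fin N → v.adicCompletion F)) :
    Integrable (fun h : localPi E c 1 J₁ v =>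
      ∫ x, ((𝓢.omegaLoc v (localCenter E c N J J₁ hJ₁ v h) Φ : SchwartzBruhat (Fin N → v.adicCompletion F)) :
            (Fin N → v.adicCompletion F) → ℂ) x *
          conj (((Φ' : SchwartzBruhat (Fin N → v.adicCompletion F)) : (Fin N → v.adicCompletion F) → ℂ) x)
          ∂(Measure.pi fun _ : Fin N => μ')) dh := by
  obtain ⟨K₀, z₀, hKo, hKc, hK1, hz₀, hcover⟩ := exists_compactOpen_and_generator_of_split J₁ hJ₁ v hc hJ₁c w hw
  exact 𝓢.integrable_localCoeff_of_darboux_of_cosets J₁ hJ₁ hTd v w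
    (splitDarboux F E c N hcδ hδ hd T v hT w hw)
    (fun z => splitCoord F E c hcδ hδ v w fun w' =>
      (((z : LocalGLPi E 1 v) w' : GL (Fin 1) (w'.1.adicCompletion E)) : Matrix (Fin 1) (Fin 1) (w'.1.adicCompletion E)) 0 0)
    (fun z => valued_splitCoord F E c hcδ hδ hd v w hw _)
    (fun z a₀ ha₀ => iota_localCenter_eq F E c N hcδ hδ hd T hJ v hT hTd (isUnit_det_localGram F N T hTd v) w hw hJ₁ z a₀ ha₀)
    μ' hL2 K₀ hKo hK1 z₀ (by norm_num) hz₀ hcover dh hKc.measure_lt_top.ne Φ Φ'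

end Literature.NumberTheory.GelbartRogawski1991.UnitaryDualPair.LocalSplitting.FinLocalSplittings

end
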